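import Summits.AtomisticToContinuum.Crystallization.Theorems.ExcessDecayLiouvilleEnergyIdentity

/-!
# Route `ExcessDecayLiouville`: the Caccioppoli identity for the force-constant operator

Step (c1) of the energy route to interior decay (item `ExcessDecay`, stmt-AtomisticToContinuum-9334; see the
item evidence `ExcessDecay-proof-architecture-v2.md`, §5).  For a BOUNDED displacement `h` on the sites of an
admissible datum and a finitely supported scalar cutoff `η`, with `K(e)w = h(|e|²)w + 2⟪e,w⟫h′(|e|²)e` and
`(L v)(p) = Σ'_{q≠p} K(p−q)(v p − v q)`:

`Σ'_p ⟪(L(ηh))(p), η_p h_p⟫ = Σ'_p η_p² ⟪(L h)(p), h_p⟫ + ½ Σ'_p Σ'_q [p≠q] (η_p − η_q)² ⟪K(p−q) h_p, h_q⟫`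

(`caccioppoli_identity`).  When `L h = 0` where `η ≠ 0` the first term drops, and harmonic stability
(`coercive_of_phononStability`) turns the identity into the discrete Caccioppoli inequality
`κ · nnForm(ηh) ≤ ½ ΣΣ (η_p − η_q)² ⟪K(p−q) h_p, h_q⟫` (`caccioppoli_inequality`), whose right-hand side is
`O(ρ⁻² Σ |h|²)` for a cutoff of slope `1/ρ` because `|K(e)| = O(|e|⁻⁸)`.  Proof: the symmetric bilinear form
`k(x,y) = ⟪K(e)x, y⟫` satisfies `k(η_p h_p − η_q h_q, η_p h_p) − η_p² k(h_p − h_q, h_p) = η_p(η_p − η_q) k(h_p, h_q)`,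
and symmetrising in `(p,q)` (Fubini for the absolutely summable double families) gives `½(η_p − η_q)² k(h_p,h_q)`.
All `[folklore]`; helper lemmas, nothing here closes an item.
-/

noncomputable section

namespace Summit.AtomisticToContinuum.Crystallization.Theorems.ExcessDecayLiouville

open scoped BigOperators Topology InnerProductSpace RealInnerProductSpace
open Literature.MathematicalPhysics.StatisticalMechanics
open Summit.AtomisticToContinuum.Crystallization.Theorems.PhononStabilityNegative

/-! ## Algebra of the symmetric form `k(x,y) = ⟪K(e)x, y⟫` -/

/-- `k(x, y) = ⟪K(e)x, y⟫` is symmetric. [folklore] -/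
theorem inner_forceConst_symm (e x y : (EuclideanSpace ℝ (Fin 3))) :
    ⟪((-((‖e‖ ^ 2)⁻¹) ^ 7 + ((‖e‖ ^ 2)⁻¹) ^ 4) • (x) + (2 * ⟪e, x⟫ * (7 * ((‖e‖ ^ 2)⁻¹) ^ 8 - 4 * ((‖e‖ ^ 2)⁻¹) ^ 5)) • (e)), y⟫ = ⟪((-((‖e‖ ^ 2)⁻¹) ^ 7 + ((‖e‖ ^ 2)⁻¹) ^ 4) • (y) + (2 * ⟪e, y⟫ * (7 * ((‖e‖ ^ 2)⁻¹) ^ 8 - 4 * ((‖e‖ ^ 2)⁻¹) ^ 5)) • (e)), x⟫ := by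
  simp only [inner_add_left, real_inner_smul_left, real_inner_comm x y]
  ring

/-- The cutoff algebra: `k(ηₚhₚ − η_qh_q, ηₚhₚ) − ηₚ² k(hₚ − h_q, hₚ) = ηₚ(ηₚ − η_q) k(hₚ, h_q)`. [folklore] -/
theorem inner_forceConst_cutoff (e hp hq : (EuclideanSpace ℝ (Fin 3))) (a b : ℝ) :
    ⟪((-((‖e‖ ^ 2)⁻¹) ^ 7 + ((‖e‖ ^ 2)⁻¹) ^ 4) • (a • hp - b • hq) + (2 * ⟪e, a • hp - b • hq⟫ * (7 * ((‖e‖ ^ 2)⁻¹) ^ 8 - 4 * ((‖e‖ ^ 2)⁻¹) ^ 5)) • (e)), a • hp⟫ - a ^ 2 * ⟪((-((‖e‖ ^ 2)⁻¹) ^ 7 + ((‖e‖ ^ 2)⁻¹) ^ 4) • (hp - hq) + (2 * ⟪e, hp - hq⟫ * (7 * ((‖e‖ ^ 2)⁻¹) ^ 8 - 4 * ((‖e‖ ^ 2)⁻¹) ^ 5)) • (e)), hp⟫ =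
      a * (a - b) * ⟪((-((‖e‖ ^ 2)⁻¹) ^ 7 + ((‖e‖ ^ 2)⁻¹) ^ 4) • (hp) + (2 * ⟪e, hp⟫ * (7 * ((‖e‖ ^ 2)⁻¹) ^ 8 - 4 * ((‖e‖ ^ 2)⁻¹) ^ 5)) • (e)), hq⟫ := by
  simp only [inner_add_left, inner_sub_left, inner_sub_right, real_inner_smul_left, real_inner_smul_right]
  rw [real_inner_comm hp hq]
  ring

section

variable {t : Fin 2 → (EuclideanSpace ℝ (Fin 3))} {A : (EuclideanSpace ℝ (Fin 3)) →L[ℝ] (EuclideanSpace ℝ (Fin 3))}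

/-! ## Summability with a bounded displacement -/

/-- The operator row is summable for a BOUNDED displacement: `q ↦ [p≠q] K(p−q)(h p − h q)`. [folklore] -/
theorem summable_opRow_of_bounded (hA : Adm₀ A) (hI : Inner₀ t A) {h : (EuclideanSpace ℝ (Fin 3)) → (EuclideanSpace ℝ (Fin 3))} {B : ℝ}
    (hB : ∀ x, ‖h x‖ ≤ B) (p : Sites₀ t A) :
    Summable (fun q : Sites₀ t A => (if (p : (EuclideanSpace ℝ (Fin 3))) ≠ q then ((-((‖(p : (EuclideanSpace ℝ (Fin 3))) - q‖ ^ 2)⁻¹) ^ 7 + ((‖(p : (EuclideanSpace ℝ (Fin 3))) - q‖ ^ 2)⁻¹) ^ 4) • (h p - h q) + (2 * ⟪(p : (EuclideanSpace ℝ (Fin 3))) - q, h p - h q⟫ * (7 * ((‖(p : (EuclideanSpace ℝ (Fin 3))) - q‖ ^ 2)⁻¹) ^ 8 - 4 * ((‖(p : (EuclideanSpace ℝ (Fin 3))) - q‖ ^ 2)⁻¹) ^ 5)) • ((p : (EuclideanSpace ℝ (Fin 3))) - q)) else 0)) := by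
  classical
  have hB0 : 0 ≤ B := (norm_nonneg _).trans (hB (p : (EuclideanSpace ℝ (Fin 3))))
  refine Summable.of_norm_bounded ((summable_inv_pow_eight_sites hA hI p.2).mul_left (38 * (2 * B))) fun q => ?_
  by_cases hq : (p : (EuclideanSpace ℝ (Fin 3))) = q
  · simp [hq]
  · have hne : (q : (EuclideanSpace ℝ (Fin 3))) ≠ p := fun h' => hq h'.symm
    rw [if_pos hq, if_pos hne]
    have hd : (23 / 25 : ℝ) ≤ dist (p : (EuclideanSpace ℝ (Fin 3))) q := dist_sites_ge hA hI p.2 q.2 hq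
    have he : 9 / 10 ≤ ‖(p : (EuclideanSpace ℝ (Fin 3))) - q‖ := by rw [← dist_eq_norm]; linarith
    refine (norm_forceConst_apply_le he _).trans ?_
    have hw : ‖h p - h q‖ ≤ 2 * B := by
      calc ‖h p - h q‖ ≤ ‖h p‖ + ‖h q‖ := norm_sub_le _ _
        _ ≤ B + B := add_le_add (hB _) (hB _)
        _ = 2 * B := by ring
    have h8 : 0 ≤ (‖(p : (EuclideanSpace ℝ (Fin 3))) - q‖⁻¹) ^ 8 := by positivity
    calc 38 * (‖(p : (EuclideanSpace ℝ (Fin 3))) - q‖⁻¹) ^ 8 * ‖h p - h q‖ ≤ 38 * (‖(p : (EuclideanSpace ℝ (Fin 3))) - q‖⁻¹) ^ 8 * (2 * B) := by gcongr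
      _ = 38 * (2 * B) * (dist (q : (EuclideanSpace ℝ (Fin 3))) p)⁻¹ ^ 8 := by rw [dist_comm, dist_eq_norm]; ring

/-- The family `Ψ(p,q) = [p≠q] η_p² ⟪K(p−q)(h_p − h_q), h_p⟫` is absolutely summable on `S × S`
(finitely many nonzero rows, each `O(|p−q|⁻⁸)`). [folklore] -/
theorem summable_psiFamily (hA : Adm₀ A) (hI : Inner₀ t A) {h : (EuclideanSpace ℝ (Fin 3)) → (EuclideanSpace ℝ (Fin 3))} {B : ℝ}
    (hB : ∀ x, ‖h x‖ ≤ B) {η : (EuclideanSpace ℝ (Fin 3)) → ℝ} (hη : (Function.support η).Finite) :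
    Summable (fun pq : Sites₀ t A × Sites₀ t A =>
      (if (pq.1 : (EuclideanSpace ℝ (Fin 3))) ≠ pq.2 then (η pq.1) ^ 2 *
        ⟪((-((‖(pq.1 : (EuclideanSpace ℝ (Fin 3))) - pq.2‖ ^ 2)⁻¹) ^ 7 + ((‖(pq.1 : (EuclideanSpace ℝ (Fin 3))) - pq.2‖ ^ 2)⁻¹) ^ 4) • (h pq.1 - h pq.2) + (2 * ⟪(pq.1 : (EuclideanSpace ℝ (Fin 3))) - pq.2, h pq.1 - h pq.2⟫ * (7 * ((‖(pq.1 : (EuclideanSpace ℝ (Fin 3))) - pq.2‖ ^ 2)⁻¹) ^ 8 - 4 * ((‖(pq.1 : (EuclideanSpace ℝ (Fin 3))) - pq.2‖ ^ 2)⁻¹) ^ 5)) • ((pq.1 : (EuclideanSpace ℝ (Fin 3))) - pq.2)), h pq.1⟫ else 0)) := by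
  classical
  have hB0 : 0 ≤ B := (norm_nonneg _).trans (hB 0)
  have hfin : Set.Finite {p : Sites₀ t A | η p ≠ 0} :=
    (hη.preimage Subtype.val_injective.injOn).subset fun _ hq => hq
  set M : Sites₀ t A × Sites₀ t A → ℝ := fun pq =>
    if η pq.1 ≠ 0 then (η pq.1) ^ 2 * (38 * (2 * B) * B) * (if (pq.2 : (EuclideanSpace ℝ (Fin 3))) ≠ pq.1 then
      (dist (pq.2 : (EuclideanSpace ℝ (Fin 3))) pq.1)⁻¹ ^ 8 else 0) else 0 with hM
  have hM0 : 0 ≤ M := fun pq => by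
    simp only [hM]; split_ifs <;> positivity
  have hMsum : Summable M := by
    rw [summable_prod_of_nonneg hM0]
    constructor
    · intro p
      by_cases hp : η p ≠ 0
      · simp only [hM, if_pos hp]
        exact (summable_inv_pow_eight_sites hA hI p.2).mul_left _
      · simp only [hM, if_neg hp]
        exact summable_zero
    · refine summable_of_ne_finset_zero (s := hfin.toFinset) ?_
      intro p hp
      have hηp : ¬ η p ≠ 0 := fun h' => hp ((Set.Finite.mem_toFinset _).2 h')
      simp only [hM, if_neg hηp, tsum_zero]
  refine Summable.of_norm_bounded hMsum fun pq => ?_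
  obtain ⟨p, q⟩ := pq
  by_cases hηp : η p = 0
  · simp only [hηp]
    split_ifs <;> simp [hM, hηp]
  · by_cases hpq : (p : (EuclideanSpace ℝ (Fin 3))) = q
    · simp only [hpq, ne_eq, not_true_eq_false, if_false, norm_zero]
      exact hM0 _
    · have hne : (q : (EuclideanSpace ℝ (Fin 3))) ≠ p := fun h' => hpq h'.symm
      simp only [hM, if_pos hpq, if_pos hηp, if_pos hne, Real.norm_eq_abs, abs_mul, abs_pow, sq_abs]
      have hd : (23 / 25 : ℝ) ≤ dist (p : (EuclideanSpace ℝ (Fin 3))) q := dist_sites_ge hA hI p.2 q.2 hpq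
      have he : 9 / 10 ≤ ‖(p : (EuclideanSpace ℝ (Fin 3))) - q‖ := by rw [← dist_eq_norm]; linarith
      have hη2 : 0 ≤ (η p) ^ 2 := sq_nonneg _
      have hw : ‖h p - h q‖ ≤ 2 * B := by
        calc ‖h p - h q‖ ≤ ‖h p‖ + ‖h q‖ := norm_sub_le _ _
          _ ≤ B + B := add_le_add (hB _) (hB _)
          _ = 2 * B := by ring
      have h8 : 0 ≤ (‖(p : (EuclideanSpace ℝ (Fin 3))) - q‖⁻¹) ^ 8 := by positivity
      have hin : |⟪((-((‖(p : (EuclideanSpace ℝ (Fin 3))) - q‖ ^ 2)⁻¹) ^ 7 + ((‖(p : (EuclideanSpace ℝ (Fin 3))) - q‖ ^ 2)⁻¹) ^ 4) • (h p - h q) + (2 * ⟪(p : (EuclideanSpace ℝ (Fin 3))) - q, h p - h q⟫ * (7 * ((‖(p : (EuclideanSpace ℝ (Fin 3))) - q‖ ^ 2)⁻¹) ^ 8 - 4 * ((‖(p : (EuclideanSpace ℝ (Fin 3))) - q‖ ^ 2)⁻¹) ^ 5)) • ((p : (EuclideanSpace ℝ (Fin 3))) - q)), h p⟫| ≤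
          38 * (2 * B) * B * (dist (q : (EuclideanSpace ℝ (Fin 3))) p)⁻¹ ^ 8 := by
        refine (abs_real_inner_le_norm _ _).trans ?_
        refine (mul_le_mul (norm_forceConst_apply_le he _) (hB p) (norm_nonneg _) (by positivity)).trans ?_
        calc 38 * (‖(p : (EuclideanSpace ℝ (Fin 3))) - q‖⁻¹) ^ 8 * ‖h p - h q‖ * B
            ≤ 38 * (‖(p : (EuclideanSpace ℝ (Fin 3))) - q‖⁻¹) ^ 8 * (2 * B) * B := by gcongr
          _ = 38 * (2 * B) * B * (dist (q : (EuclideanSpace ℝ (Fin 3))) p)⁻¹ ^ 8 := by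
              rw [dist_comm, dist_eq_norm]; ring
      calc (η p) ^ 2 * |⟪((-((‖(p : (EuclideanSpace ℝ (Fin 3))) - q‖ ^ 2)⁻¹) ^ 7 + ((‖(p : (EuclideanSpace ℝ (Fin 3))) - q‖ ^ 2)⁻¹) ^ 4) • (h p - h q) + (2 * ⟪(p : (EuclideanSpace ℝ (Fin 3))) - q, h p - h q⟫ * (7 * ((‖(p : (EuclideanSpace ℝ (Fin 3))) - q‖ ^ 2)⁻¹) ^ 8 - 4 * ((‖(p : (EuclideanSpace ℝ (Fin 3))) - q‖ ^ 2)⁻¹) ^ 5)) • ((p : (EuclideanSpace ℝ (Fin 3))) - q)), h p⟫|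
          ≤ (η p) ^ 2 * (38 * (2 * B) * B * (dist (q : (EuclideanSpace ℝ (Fin 3))) p)⁻¹ ^ 8) :=
            mul_le_mul_of_nonneg_left hin hη2
        _ = (η p) ^ 2 * (38 * (2 * B) * B) * (dist (q : (EuclideanSpace ℝ (Fin 3))) p)⁻¹ ^ 8 := by ring

/-! ## The identity -/

/-- **Caccioppoli identity** (see the module docstring). [folklore] -/
theorem caccioppoli_identity (hA : Adm₀ A) (hI : Inner₀ t A) {h : (EuclideanSpace ℝ (Fin 3)) → (EuclideanSpace ℝ (Fin 3))} {B : ℝ}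
    (hB : ∀ x, ‖h x‖ ≤ B) {η : (EuclideanSpace ℝ (Fin 3)) → ℝ} (hη : (Function.support η).Finite)
    {a : (EuclideanSpace ℝ (Fin 3)) → (EuclideanSpace ℝ (Fin 3))} (ha_def : ∀ x, a x = η x • h x) :
    (∑' p : Sites₀ t A, ⟪∑' q : Sites₀ t A, (if (p : (EuclideanSpace ℝ (Fin 3))) ≠ q then ((-((‖(p : (EuclideanSpace ℝ (Fin 3))) - q‖ ^ 2)⁻¹) ^ 7 + ((‖(p : (EuclideanSpace ℝ (Fin 3))) - q‖ ^ 2)⁻¹) ^ 4) • (a p - a q) + (2 * ⟪(p : (EuclideanSpace ℝ (Fin 3))) - q, a p - a q⟫ * (7 * ((‖(p : (EuclideanSpace ℝ (Fin 3))) - q‖ ^ 2)⁻¹) ^ 8 - 4 * ((‖(p : (EuclideanSpace ℝ (Fin 3))) - q‖ ^ 2)⁻¹) ^ 5)) • ((p : (EuclideanSpace ℝ (Fin 3))) - q)) else 0), a p⟫) =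
      (∑' p : Sites₀ t A, (η p) ^ 2 * ⟪∑' q : Sites₀ t A, (if (p : (EuclideanSpace ℝ (Fin 3))) ≠ q then ((-((‖(p : (EuclideanSpace ℝ (Fin 3))) - q‖ ^ 2)⁻¹) ^ 7 + ((‖(p : (EuclideanSpace ℝ (Fin 3))) - q‖ ^ 2)⁻¹) ^ 4) • (h p - h q) + (2 * ⟪(p : (EuclideanSpace ℝ (Fin 3))) - q, h p - h q⟫ * (7 * ((‖(p : (EuclideanSpace ℝ (Fin 3))) - q‖ ^ 2)⁻¹) ^ 8 - 4 * ((‖(p : (EuclideanSpace ℝ (Fin 3))) - q‖ ^ 2)⁻¹) ^ 5)) • ((p : (EuclideanSpace ℝ (Fin 3))) - q)) else 0), h p⟫) +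
      (1 / 2 : ℝ) * ∑' p : Sites₀ t A, ∑' q : Sites₀ t A, (if (p : (EuclideanSpace ℝ (Fin 3))) ≠ q then (η p - η q) ^ 2 * ⟪((-((‖(p : (EuclideanSpace ℝ (Fin 3))) - q‖ ^ 2)⁻¹) ^ 7 + ((‖(p : (EuclideanSpace ℝ (Fin 3))) - q‖ ^ 2)⁻¹) ^ 4) • (h p) + (2 * ⟪(p : (EuclideanSpace ℝ (Fin 3))) - q, h p⟫ * (7 * ((‖(p : (EuclideanSpace ℝ (Fin 3))) - q‖ ^ 2)⁻¹) ^ 8 - 4 * ((‖(p : (EuclideanSpace ℝ (Fin 3))) - q‖ ^ 2)⁻¹) ^ 5)) • ((p : (EuclideanSpace ℝ (Fin 3))) - q)), h q⟫ else 0) := by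
  classical
  -- the cut-off displacement a = η • h is finitely supported
  have ha : (Function.support a).Finite :=
    hη.subset fun x hx => by
      rw [Function.mem_support, ha_def] at hx
      rw [Function.mem_support]
      intro h0
      exact hx (by rw [h0, zero_smul])
  -- summable double families Φ (for a) and Ψ
  have hΦ : Summable (Function.uncurry fun (p q : Sites₀ t A) => (if (p : (EuclideanSpace ℝ (Fin 3))) ≠ q then ⟪((-((‖(p : (EuclideanSpace ℝ (Fin 3))) - q‖ ^ 2)⁻¹) ^ 7 + ((‖(p : (EuclideanSpace ℝ (Fin 3))) - q‖ ^ 2)⁻¹) ^ 4) • (a p - a q) + (2 * ⟪(p : (EuclideanSpace ℝ (Fin 3))) - q, a p - a q⟫ * (7 * ((‖(p : (EuclideanSpace ℝ (Fin 3))) - q‖ ^ 2)⁻¹) ^ 8 - 4 * ((‖(p : (EuclideanSpace ℝ (Fin 3))) - q‖ ^ 2)⁻¹) ^ 5)) • ((p : (EuclideanSpace ℝ (Fin 3))) - q)), a p⟫ else 0)) :=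
    summable_pairFamily hA hI ha
  have hΨ : Summable (Function.uncurry fun (p q : Sites₀ t A) => (if (p : (EuclideanSpace ℝ (Fin 3))) ≠ q then (η p) ^ 2 * ⟪((-((‖(p : (EuclideanSpace ℝ (Fin 3))) - q‖ ^ 2)⁻¹) ^ 7 + ((‖(p : (EuclideanSpace ℝ (Fin 3))) - q‖ ^ 2)⁻¹) ^ 4) • (h p - h q) + (2 * ⟪(p : (EuclideanSpace ℝ (Fin 3))) - q, h p - h q⟫ * (7 * ((‖(p : (EuclideanSpace ℝ (Fin 3))) - q‖ ^ 2)⁻¹) ^ 8 - 4 * ((‖(p : (EuclideanSpace ℝ (Fin 3))) - q‖ ^ 2)⁻¹) ^ 5)) • ((p : (EuclideanSpace ℝ (Fin 3))) - q)), h p⟫ else 0)) :=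
    summable_psiFamily hA hI hB hη
  have hD := hΦ.sub hΨ
  -- pointwise: (Φ − Ψ)(p,q) = η_p (η_p − η_q) k(h_p,h_q), and its symmetrisation is Ξ
  have hpt : ∀ p q : Sites₀ t A, (if (p : (EuclideanSpace ℝ (Fin 3))) ≠ q then ⟪((-((‖(p : (EuclideanSpace ℝ (Fin 3))) - q‖ ^ 2)⁻¹) ^ 7 + ((‖(p : (EuclideanSpace ℝ (Fin 3))) - q‖ ^ 2)⁻¹) ^ 4) • (a p - a q) + (2 * ⟪(p : (EuclideanSpace ℝ (Fin 3))) - q, a p - a q⟫ * (7 * ((‖(p : (EuclideanSpace ℝ (Fin 3))) - q‖ ^ 2)⁻¹) ^ 8 - 4 * ((‖(p : (EuclideanSpace ℝ (Fin 3))) - q‖ ^ 2)⁻¹) ^ 5)) • ((p : (EuclideanSpace ℝ (Fin 3))) - q)), a p⟫ else 0) - (if (p : (EuclideanSpace ℝ (Fin 3))) ≠ q then (η p) ^ 2 * ⟪((-((‖(p : (EuclideanSpace ℝ (Fin 3))) - q‖ ^ 2)⁻¹) ^ 7 + ((‖(p : (EuclideanSpace ℝ (Fin 3))) - q‖ ^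 2)⁻¹) ^ 4) • (h p - h q) + (2 * ⟪(p : (EuclideanSpace ℝ (Fin 3))) - q, h p - h q⟫ * (7 * ((‖(p : (EuclideanSpace ℝ (Fin 3))) - q‖ ^ 2)⁻¹) ^ 8 - 4 * ((‖(p : (EuclideanSpace ℝ (Fin 3))) - q‖ ^ 2)⁻¹) ^ 5)) • ((p : (EuclideanSpace ℝ (Fin 3))) - q)), h p⟫ else 0) =
      (if (p : (EuclideanSpace ℝ (Fin 3))) ≠ q then η p * (η p - η q) * ⟪((-((‖(p : (EuclideanSpace ℝ (Fin 3))) - q‖ ^ 2)⁻¹) ^ 7 + ((‖(p : (EuclideanSpace ℝ (Fin 3))) - q‖ ^ 2)⁻¹) ^ 4) • (h p) + (2 * ⟪(p : (EuclideanSpace ℝ (Fin 3))) - q, h p⟫ * (7 * ((‖(p : (EuclideanSpace ℝ (Fin 3))) - q‖ ^ 2)⁻¹) ^ 8 - 4 * ((‖(p : (EuclideanSpace ℝ (Fin 3))) - q‖ ^ 2)⁻¹) ^ 5)) • ((p : (EuclideanSpace ℝ (Fin 3))) - q)), h q⟫ else 0) := by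
    intro p q
    by_cases hpq : (p : (EuclideanSpace ℝ (Fin 3))) = q
    · simp [hpq]
    · rw [if_pos hpq, if_pos hpq, if_pos hpq, ha_def, ha_def]
      exact inner_forceConst_cutoff _ _ _ _ _
  have hsym : ∀ p q : Sites₀ t A,
      (if (p : (EuclideanSpace ℝ (Fin 3))) ≠ q then η p * (η p - η q) * ⟪((-((‖(p : (EuclideanSpace ℝ (Fin 3))) - q‖ ^ 2)⁻¹) ^ 7 + ((‖(p : (EuclideanSpace ℝ (Fin 3))) - q‖ ^ 2)⁻¹) ^ 4) • (h p) + (2 * ⟪(p : (EuclideanSpace ℝ (Fin 3))) - q, h p⟫ * (7 * ((‖(p : (EuclideanSpace ℝ (Fin 3))) - q‖ ^ 2)⁻¹) ^ 8 - 4 * ((‖(p : (EuclideanSpace ℝ (Fin 3))) - q‖ ^ 2)⁻¹) ^ 5)) • ((p : (EuclideanSpace ℝ (Fin 3))) - q)), h q⟫ else 0) +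
      (if (q : (EuclideanSpace ℝ (Fin 3))) ≠ p then η q * (η q - η p) * ⟪((-((‖(q : (EuclideanSpace ℝ (Fin 3))) - p‖ ^ 2)⁻¹) ^ 7 + ((‖(q : (EuclideanSpace ℝ (Fin 3))) - p‖ ^ 2)⁻¹) ^ 4) • (h q) + (2 * ⟪(q : (EuclideanSpace ℝ (Fin 3))) - p, h q⟫ * (7 * ((‖(q : (EuclideanSpace ℝ (Fin 3))) - p‖ ^ 2)⁻¹) ^ 8 - 4 * ((‖(q : (EuclideanSpace ℝ (Fin 3))) - p‖ ^ 2)⁻¹) ^ 5)) • ((q : (EuclideanSpace ℝ (Fin 3))) - p)), h p⟫ else 0) = (if (p : (EuclideanSpace ℝ (Fin 3))) ≠ q then (η p - η q) ^ 2 * ⟪((-((‖(p : (EuclideanSpace ℝ (Fin 3))) - q‖ ^ 2)⁻¹) ^ 7 + ((‖(p : (EuclideanSpace ℝ (Fin 3))) - q‖ ^ 2)⁻¹) ^ 4) • (h p) + (2 * ⟪(p : (EuclideanSpace ℝ (Fin 3))) - q, h p⟫ * (7 * ((‖(p : (EuclideanSpace ℝ (Fin 3))) - q‖ ^ 2)⁻¹)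 ^ 8 - 4 * ((‖(p : (EuclideanSpace ℝ (Fin 3))) - q‖ ^ 2)⁻¹) ^ 5)) • ((p : (EuclideanSpace ℝ (Fin 3))) - q)), h q⟫ else 0) := by
    intro p q
    by_cases hpq : (p : (EuclideanSpace ℝ (Fin 3))) = q
    · simp [hpq]
    · have hqp : (q : (EuclideanSpace ℝ (Fin 3))) ≠ p := fun h' => hpq h'.symm
      rw [if_pos hpq, if_pos hqp, if_pos hpq]
      have hK : ((-((‖(q : (EuclideanSpace ℝ (Fin 3))) - p‖ ^ 2)⁻¹) ^ 7 + ((‖(q : (EuclideanSpace ℝ (Fin 3))) - p‖ ^ 2)⁻¹) ^ 4) • (h q) + (2 * ⟪(q : (EuclideanSpace ℝ (Fin 3))) - p, h q⟫ * (7 * ((‖(q : (EuclideanSpace ℝ (Fin 3))) - p‖ ^ 2)⁻¹) ^ 8 - 4 * ((‖(q : (EuclideanSpace ℝ (Fin 3))) - p‖ ^ 2)⁻¹) ^ 5)) • ((q : (EuclideanSpace ℝ (Fin 3))) - p)) = ((-((‖-((p : (EuclideanSpace ℝ (Fin 3))) - q)‖ ^ 2)⁻¹) ^ 7 + ((‖-((p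 : (EuclideanSpace ℝ (Fin 3))) - q)‖ ^ 2)⁻¹) ^ 4) • (h q) + (2 * ⟪-((p : (EuclideanSpace ℝ (Fin 3))) - q), h q⟫ * (7 * ((‖-((p : (EuclideanSpace ℝ (Fin 3))) - q)‖ ^ 2)⁻¹) ^ 8 - 4 * ((‖-((p : (EuclideanSpace ℝ (Fin 3))) - q)‖ ^ 2)⁻¹) ^ 5)) • (-((p : (EuclideanSpace ℝ (Fin 3))) - q))) := by rw [neg_sub]
      rw [hK, forceConst_neg_left, inner_forceConst_symm ((p : (EuclideanSpace ℝ (Fin 3))) - q) (h q) (h p)]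
      ring
  -- Fubini bookkeeping
  set D : Sites₀ t A → Sites₀ t A → ℝ := fun p q =>
    (if (p : (EuclideanSpace ℝ (Fin 3))) ≠ q then η p * (η p - η q) * ⟪((-((‖(p : (EuclideanSpace ℝ (Fin 3))) - q‖ ^ 2)⁻¹) ^ 7 + ((‖(p : (EuclideanSpace ℝ (Fin 3))) - q‖ ^ 2)⁻¹) ^ 4) • (h p) + (2 * ⟪(p : (EuclideanSpace ℝ (Fin 3))) - q, h p⟫ * (7 * ((‖(p : (EuclideanSpace ℝ (Fin 3))) - q‖ ^ 2)⁻¹) ^ 8 - 4 * ((‖(p : (EuclideanSpace ℝ (Fin 3))) - q‖ ^ 2)⁻¹) ^ 5)) • ((p : (EuclideanSpace ℝ (Fin 3))) - q)), h q⟫ else 0) with hDdef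
  have hDs : Summable (Function.uncurry D) := by
    refine hD.congr fun pq => ?_
    obtain ⟨p, q⟩ := pq
    simp only [Function.uncurry_apply_pair, hDdef]
    exact hpt p q
  have hrows : ∀ p, Summable (D p) := fun p => hDs.prod_factor p
  have hcols : ∀ p, Summable (fun q => D q p) := fun p => hDs.prod_symm.prod_factor p
  have hout1 : Summable (fun p => ∑' q, D p q) := hDs.prod
  have hout2 : Summable (fun p => ∑' q, D q p) := hDs.prod_symm.prod
  have hcomm : (∑' p, ∑' q, D q p) = ∑' p, ∑' q, D p q := hDs.tsum_comm
  -- ΣΣ D = ½ ΣΣ Ξ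
  have hhalf : (∑' p, ∑' q, D p q) = (1 / 2 : ℝ) * ∑' p : Sites₀ t A, ∑' q : Sites₀ t A, (if (p : (EuclideanSpace ℝ (Fin 3))) ≠ q then (η p - η q) ^ 2 * ⟪((-((‖(p : (EuclideanSpace ℝ (Fin 3))) - q‖ ^ 2)⁻¹) ^ 7 + ((‖(p : (EuclideanSpace ℝ (Fin 3))) - q‖ ^ 2)⁻¹) ^ 4) • (h p) + (2 * ⟪(p : (EuclideanSpace ℝ (Fin 3))) - q, h p⟫ * (7 * ((‖(p : (EuclideanSpace ℝ (Fin 3))) - q‖ ^ 2)⁻¹) ^ 8 - 4 * ((‖(p : (EuclideanSpace ℝ (Fin 3))) - q‖ ^ 2)⁻¹) ^ 5)) • ((p : (EuclideanSpace ℝ (Fin 3))) - q)), h q⟫ else 0) := by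
    have h2 : 2 * (∑' p, ∑' q, D p q) = ∑' p : Sites₀ t A, ∑' q : Sites₀ t A, (if (p : (EuclideanSpace ℝ (Fin 3))) ≠ q then (η p - η q) ^ 2 * ⟪((-((‖(p : (EuclideanSpace ℝ (Fin 3))) - q‖ ^ 2)⁻¹) ^ 7 + ((‖(p : (EuclideanSpace ℝ (Fin 3))) - q‖ ^ 2)⁻¹) ^ 4) • (h p) + (2 * ⟪(p : (EuclideanSpace ℝ (Fin 3))) - q, h p⟫ * (7 * ((‖(p : (EuclideanSpace ℝ (Fin 3))) - q‖ ^ 2)⁻¹) ^ 8 - 4 * ((‖(p : (EuclideanSpace ℝ (Fin 3))) - q‖ ^ 2)⁻¹) ^ 5)) • ((p : (EuclideanSpace ℝ (Fin 3))) - q)), h q⟫ else 0) := by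
      rw [two_mul]
      nth_rewrite 2 [← hcomm]
      rw [← hout1.tsum_add hout2]
      refine tsum_congr fun p => ?_
      rw [← (hrows p).tsum_add (hcols p)]
      refine tsum_congr fun q => ?_
      simp only [hDdef]
      exact hsym p q
    linarith
  -- ΣΣ Φ and ΣΣ Ψ as single sums
  have hΦrow : ∀ p : Sites₀ t A, (∑' q : Sites₀ t A, (if (p : (EuclideanSpace ℝ (Fin 3))) ≠ q then ⟪((-((‖(p : (EuclideanSpace ℝ (Fin 3))) - q‖ ^ 2)⁻¹) ^ 7 + ((‖(p : (EuclideanSpace ℝ (Fin 3))) - q‖ ^ 2)⁻¹) ^ 4) • (a p - a q) + (2 * ⟪(p : (EuclideanSpace ℝ (Fin 3))) - q, a p - a q⟫ * (7 * ((‖(p : (EuclideanSpace ℝ (Fin 3))) - q‖ ^ 2)⁻¹) ^ 8 - 4 * ((‖(p : (EuclideanSpace ℝ (Fin 3))) - q‖ ^ 2)⁻¹) ^ 5)) • ((p : (EuclideanSpace ℝ (Fin 3))) - q)), a p⟫ else 0)) =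
      ⟪∑' q : Sites₀ t A, (if (p : (EuclideanSpace ℝ (Fin 3))) ≠ q then ((-((‖(p : (EuclideanSpace ℝ (Fin 3))) - q‖ ^ 2)⁻¹) ^ 7 + ((‖(p : (EuclideanSpace ℝ (Fin 3))) - q‖ ^ 2)⁻¹) ^ 4) • (a p - a q) + (2 * ⟪(p : (EuclideanSpace ℝ (Fin 3))) - q, a p - a q⟫ * (7 * ((‖(p : (EuclideanSpace ℝ (Fin 3))) - q‖ ^ 2)⁻¹) ^ 8 - 4 * ((‖(p : (EuclideanSpace ℝ (Fin 3))) - q‖ ^ 2)⁻¹) ^ 5)) • ((p : (EuclideanSpace ℝ (Fin 3))) - q)) else 0), a p⟫ := fun p => tsum_pairRow_eq_inner hA hI ha p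
  have hΨrow : ∀ p : Sites₀ t A, (∑' q : Sites₀ t A, (if (p : (EuclideanSpace ℝ (Fin 3))) ≠ q then (η p) ^ 2 * ⟪((-((‖(p : (EuclideanSpace ℝ (Fin 3))) - q‖ ^ 2)⁻¹) ^ 7 + ((‖(p : (EuclideanSpace ℝ (Fin 3))) - q‖ ^ 2)⁻¹) ^ 4) • (h p - h q) + (2 * ⟪(p : (EuclideanSpace ℝ (Fin 3))) - q, h p - h q⟫ * (7 * ((‖(p : (EuclideanSpace ℝ (Fin 3))) - q‖ ^ 2)⁻¹) ^ 8 - 4 * ((‖(p : (EuclideanSpace ℝ (Fin 3))) - q‖ ^ 2)⁻¹) ^ 5)) • ((p : (EuclideanSpace ℝ (Fin 3))) - q)), h p⟫ else 0)) =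
      (η p) ^ 2 * ⟪∑' q : Sites₀ t A, (if (p : (EuclideanSpace ℝ (Fin 3))) ≠ q then ((-((‖(p : (EuclideanSpace ℝ (Fin 3))) - q‖ ^ 2)⁻¹) ^ 7 + ((‖(p : (EuclideanSpace ℝ (Fin 3))) - q‖ ^ 2)⁻¹) ^ 4) • (h p - h q) + (2 * ⟪(p : (EuclideanSpace ℝ (Fin 3))) - q, h p - h q⟫ * (7 * ((‖(p : (EuclideanSpace ℝ (Fin 3))) - q‖ ^ 2)⁻¹) ^ 8 - 4 * ((‖(p : (EuclideanSpace ℝ (Fin 3))) - q‖ ^ 2)⁻¹) ^ 5)) • ((p : (EuclideanSpace ℝ (Fin 3))) - q)) else 0), h p⟫ := by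
    intro p
    have hs := summable_opRow_of_bounded hA hI hB p
    rw [real_inner_comm, ← innerSL_apply_apply (𝕜 := ℝ), ContinuousLinearMap.map_tsum (innerSL ℝ (h p)) hs,
      ← tsum_mul_left]
    refine tsum_congr fun q => ?_
    by_cases hpq : (p : (EuclideanSpace ℝ (Fin 3))) = q
    · simp [hpq]
    · rw [if_pos hpq, if_pos hpq, innerSL_apply_apply, real_inner_comm]
  -- assemble
  have hΦr : ∀ p : Sites₀ t A, Summable (fun q : Sites₀ t A => (if (p : (EuclideanSpace ℝ (Fin 3))) ≠ q then ⟪((-((‖(p : (EuclideanSpace ℝ (Fin 3))) - q‖ ^ 2)⁻¹) ^ 7 + ((‖(p : (EuclideanSpace ℝ (Fin 3))) - q‖ ^ 2)⁻¹) ^ 4) • (a p - a q) + (2 * ⟪(p : (EuclideanSpace ℝ (Fin 3))) - q, a p - a q⟫ * (7 * ((‖(p : (EuclideanSpace ℝ (Fin 3))) - q‖ ^ 2)⁻¹) ^ 8 - 4 * ((‖(p : (EuclideanSpace ℝ (Fin 3))) - q‖ ^ 2)⁻¹) ^ 5)) • ((p : (EuclideanSpace ℝ (Fin 3))) - q)),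 a p⟫ else 0)) := fun p => hΦ.prod_factor p
  have hΨr : ∀ p : Sites₀ t A, Summable (fun q : Sites₀ t A => (if (p : (EuclideanSpace ℝ (Fin 3))) ≠ q then (η p) ^ 2 * ⟪((-((‖(p : (EuclideanSpace ℝ (Fin 3))) - q‖ ^ 2)⁻¹) ^ 7 + ((‖(p : (EuclideanSpace ℝ (Fin 3))) - q‖ ^ 2)⁻¹) ^ 4) • (h p - h q) + (2 * ⟪(p : (EuclideanSpace ℝ (Fin 3))) - q, h p - h q⟫ * (7 * ((‖(p : (EuclideanSpace ℝ (Fin 3))) - q‖ ^ 2)⁻¹) ^ 8 - 4 * ((‖(p : (EuclideanSpace ℝ (Fin 3))) - q‖ ^ 2)⁻¹) ^ 5)) • ((p : (EuclideanSpace ℝ (Fin 3))) - q)), h p⟫ else 0)) := fun p => hΨ.prod_factor p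
  have hΦs : Summable (fun p : Sites₀ t A => ∑' q : Sites₀ t A, (if (p : (EuclideanSpace ℝ (Fin 3))) ≠ q then ⟪((-((‖(p : (EuclideanSpace ℝ (Fin 3))) - q‖ ^ 2)⁻¹) ^ 7 + ((‖(p : (EuclideanSpace ℝ (Fin 3))) - q‖ ^ 2)⁻¹) ^ 4) • (a p - a q) + (2 * ⟪(p : (EuclideanSpace ℝ (Fin 3))) - q, a p - a q⟫ * (7 * ((‖(p : (EuclideanSpace ℝ (Fin 3))) - q‖ ^ 2)⁻¹) ^ 8 - 4 * ((‖(p : (EuclideanSpace ℝ (Fin 3))) - q‖ ^ 2)⁻¹) ^ 5)) • ((p : (EuclideanSpace ℝ (Fin 3))) - q)), a p⟫ else 0)) := hΦ.prod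
  have hΨs : Summable (fun p : Sites₀ t A => ∑' q : Sites₀ t A, (if (p : (EuclideanSpace ℝ (Fin 3))) ≠ q then (η p) ^ 2 * ⟪((-((‖(p : (EuclideanSpace ℝ (Fin 3))) - q‖ ^ 2)⁻¹) ^ 7 + ((‖(p : (EuclideanSpace ℝ (Fin 3))) - q‖ ^ 2)⁻¹) ^ 4) • (h p - h q) + (2 * ⟪(p : (EuclideanSpace ℝ (Fin 3))) - q, h p - h q⟫ * (7 * ((‖(p : (EuclideanSpace ℝ (Fin 3))) - q‖ ^ 2)⁻¹) ^ 8 - 4 * ((‖(p : (EuclideanSpace ℝ (Fin 3))) - q‖ ^ 2)⁻¹) ^ 5)) • ((p : (EuclideanSpace ℝ (Fin 3))) - q)), h p⟫ else 0)) := hΨ.prod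
  have hmain : (∑' p : Sites₀ t A, ∑' q : Sites₀ t A, (if (p : (EuclideanSpace ℝ (Fin 3))) ≠ q then ⟪((-((‖(p : (EuclideanSpace ℝ (Fin 3))) - q‖ ^ 2)⁻¹) ^ 7 + ((‖(p : (EuclideanSpace ℝ (Fin 3))) - q‖ ^ 2)⁻¹) ^ 4) • (a p - a q) + (2 * ⟪(p : (EuclideanSpace ℝ (Fin 3))) - q, a p - a q⟫ * (7 * ((‖(p : (EuclideanSpace ℝ (Fin 3))) - q‖ ^ 2)⁻¹) ^ 8 - 4 * ((‖(p : (EuclideanSpace ℝ (Fin 3))) - q‖ ^ 2)⁻¹) ^ 5)) • ((p : (EuclideanSpace ℝ (Fin 3))) - q)), a p⟫ else 0)) -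
      (∑' p : Sites₀ t A, ∑' q : Sites₀ t A, (if (p : (EuclideanSpace ℝ (Fin 3))) ≠ q then (η p) ^ 2 * ⟪((-((‖(p : (EuclideanSpace ℝ (Fin 3))) - q‖ ^ 2)⁻¹) ^ 7 + ((‖(p : (EuclideanSpace ℝ (Fin 3))) - q‖ ^ 2)⁻¹) ^ 4) • (h p - h q) + (2 * ⟪(p : (EuclideanSpace ℝ (Fin 3))) - q, h p - h q⟫ * (7 * ((‖(p : (EuclideanSpace ℝ (Fin 3))) - q‖ ^ 2)⁻¹) ^ 8 - 4 * ((‖(p : (EuclideanSpace ℝ (Fin 3))) - q‖ ^ 2)⁻¹) ^ 5)) • ((p : (EuclideanSpace ℝ (Fin 3))) - q)), h p⟫ else 0)) = ∑' p, ∑' q, D p q := by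
    rw [← hΦs.tsum_sub hΨs]
    refine tsum_congr fun p => ?_
    rw [← (hΦr p).tsum_sub (hΨr p)]
    refine tsum_congr fun q => ?_
    simp only [hDdef]
    exact hpt p q
  rw [tsum_congr hΦrow, tsum_congr hΨrow] at hmain
  linarith [hmain, hhalf]

/-- **Caccioppoli inequality.**  Under `PhononStability` (with its constant `κ` from
`coercive_of_phononStability`): if the cutoff `η` is supported on the sites and `(L h)(p) = 0` wherever
`η p ≠ 0`, then `κ · nnForm t A (η • h) ≤ ½ Σ'Σ' [p≠q] (η_p − η_q)² ⟪K(p−q) h_p, h_q⟫`. [folklore] -/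
theorem caccioppoli_inequality (hA : Adm₀ A) (hI : Inner₀ t A) {κ : ℝ}
    (hκ : ∀ v : (EuclideanSpace ℝ (Fin 3)) → (EuclideanSpace ℝ (Fin 3)), (Function.support v).Finite → Function.support v ⊆ Sites₀ t A →
      κ * nnForm t A v ≤ ∑' p : Sites₀ t A, ⟪∑' q : Sites₀ t A,
        (if (p : (EuclideanSpace ℝ (Fin 3))) ≠ q then ((-((‖(p : (EuclideanSpace ℝ (Fin 3))) - q‖ ^ 2)⁻¹) ^ 7 + ((‖(p : (EuclideanSpace ℝ (Fin 3))) - q‖ ^ 2)⁻¹) ^ 4) • (v p - v q) + (2 * ⟪(p : (EuclideanSpace ℝ (Fin 3))) - q, v p - v q⟫ * (7 * ((‖(p : (EuclideanSpace ℝ (Fin 3))) - q‖ ^ 2)⁻¹) ^ 8 - 4 * ((‖(p : (EuclideanSpace ℝ (Fin 3))) - q‖ ^ 2)⁻¹) ^ 5)) • ((p : (EuclideanSpace ℝ (Fin 3))) - q)) else 0), v p⟫)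
    {h : (EuclideanSpace ℝ (Fin 3)) → (EuclideanSpace ℝ (Fin 3))} {B : ℝ} (hB : ∀ x, ‖h x‖ ≤ B) {η : (EuclideanSpace ℝ (Fin 3)) → ℝ} (hη : (Function.support η).Finite)
    (hηS : Function.support η ⊆ Sites₀ t A)
    (hharm : ∀ p : Sites₀ t A, η p ≠ 0 → (∑' q : Sites₀ t A, (if (p : (EuclideanSpace ℝ (Fin 3))) ≠ q then ((-((‖(p : (EuclideanSpace ℝ (Fin 3))) - q‖ ^ 2)⁻¹) ^ 7 + ((‖(p : (EuclideanSpace ℝ (Fin 3))) - q‖ ^ 2)⁻¹) ^ 4) • (h p - h q) + (2 * ⟪(p : (EuclideanSpace ℝ (Fin 3))) - q, h p - h q⟫ * (7 * ((‖(p : (EuclideanSpace ℝ (Fin 3))) - q‖ ^ 2)⁻¹) ^ 8 - 4 * ((‖(p : (EuclideanSpace ℝ (Fin 3))) - q‖ ^ 2)⁻¹) ^ 5)) • ((p : (EuclideanSpace ℝ (Fin 3))) - q)) else 0)) = 0) :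
    κ * nnForm t A (fun x => η x • h x) ≤
      (1 / 2 : ℝ) * ∑' p : Sites₀ t A, ∑' q : Sites₀ t A, (if (p : (EuclideanSpace ℝ (Fin 3))) ≠ q then (η p - η q) ^ 2 * ⟪((-((‖(p : (EuclideanSpace ℝ (Fin 3))) - q‖ ^ 2)⁻¹) ^ 7 + ((‖(p : (EuclideanSpace ℝ (Fin 3))) - q‖ ^ 2)⁻¹) ^ 4) • (h p) + (2 * ⟪(p : (EuclideanSpace ℝ (Fin 3))) - q, h p⟫ * (7 * ((‖(p : (EuclideanSpace ℝ (Fin 3))) - q‖ ^ 2)⁻¹) ^ 8 - 4 * ((‖(p : (EuclideanSpace ℝ (Fin 3))) - q‖ ^ 2)⁻¹) ^ 5)) • ((p : (EuclideanSpace ℝ (Fin 3))) - q)), h q⟫ else 0) := by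
  have ha : (Function.support fun x : (EuclideanSpace ℝ (Fin 3)) => η x • h x).Finite :=
    hη.subset fun x hx => by
      simp only [Function.mem_support, ne_eq, smul_eq_zero, not_or] at hx ⊢
      exact hx.1
  have haS : (Function.support fun x : (EuclideanSpace ℝ (Fin 3)) => η x • h x) ⊆ Sites₀ t A := fun x hx => by
    apply hηS
    simp only [Function.mem_support, ne_eq, smul_eq_zero, not_or] at hx ⊢
    exact hx.1
  have h1 := hκ _ ha haS
  have h2 := caccioppoli_identity hA hI hB hη (a := fun x => η x • h x) (fun x => rfl)
  have h3 : (∑' p : Sites₀ t A, (η p) ^ 2 * ⟪∑' q : Sites₀ t A, (if (p : (EuclideanSpace ℝ (Fin 3))) ≠ q then ((-((‖(p : (EuclideanSpace ℝ (Fin 3))) - q‖ ^ 2)⁻¹) ^ 7 + ((‖(p : (EuclideanSpace ℝ (Fin 3))) - q‖ ^ 2)⁻¹) ^ 4) • (h p - h q) + (2 * ⟪(p : (EuclideanSpace ℝ (Fin 3))) - q, h p - h q⟫ * (7 * ((‖(p : (EuclideanSpace ℝ (Fin 3))) - q‖ ^ 2)⁻¹) ^ 8 - 4 * ((‖(p :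 (EuclideanSpace ℝ (Fin 3))) - q‖ ^ 2)⁻¹) ^ 5)) • ((p : (EuclideanSpace ℝ (Fin 3))) - q)) else 0), h p⟫) = 0 := by
    have hz : ∀ p : Sites₀ t A, (η p) ^ 2 * ⟪∑' q : Sites₀ t A, (if (p : (EuclideanSpace ℝ (Fin 3))) ≠ q then ((-((‖(p : (EuclideanSpace ℝ (Fin 3))) - q‖ ^ 2)⁻¹) ^ 7 + ((‖(p : (EuclideanSpace ℝ (Fin 3))) - q‖ ^ 2)⁻¹) ^ 4) • (h p - h q) + (2 * ⟪(p : (EuclideanSpace ℝ (Fin 3))) - q, h p - h q⟫ * (7 * ((‖(p : (EuclideanSpace ℝ (Fin 3))) - q‖ ^ 2)⁻¹) ^ 8 - 4 * ((‖(p : (EuclideanSpace ℝ (Fin 3))) - q‖ ^ 2)⁻¹) ^ 5)) • ((p : (EuclideanSpace ℝ (Fin 3))) - q)) else 0), h p⟫ = 0 := by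
      intro p
      by_cases hp : η p = 0
      · simp [hp]
      · rw [hharm p hp, inner_zero_left, mul_zero]
    simp only [hz, tsum_zero]
  linarith [h1, h2, h3]

/-- **Caccioppoli inequality, inhomogeneous form**: without any harmonicity assumption,
`κ · nnForm t A (η • h) ≤ Σ'_p η_p² ⟪(L h)(p), h_p⟫ + ½ Σ'Σ' [p≠q] (η_p − η_q)² ⟪K(p−q) h_p, h_q⟫`
(coercivity of `coercive_of_phononStability` + `caccioppoli_identity`).  The first term is the work of the
residual force `L h` against `η² h`, small when `h` nearly solves the linearised equation. [folklore] -/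
theorem caccioppoli_inhomogeneous (hA : Adm₀ A) (hI : Inner₀ t A) {κ : ℝ}
    (hκ : ∀ v : (EuclideanSpace ℝ (Fin 3)) → (EuclideanSpace ℝ (Fin 3)), (Function.support v).Finite → Function.support v ⊆ Sites₀ t A →
      κ * nnForm t A v ≤ ∑' p : Sites₀ t A, ⟪∑' q : Sites₀ t A,
        (if (p : (EuclideanSpace ℝ (Fin 3))) ≠ q then ((-((‖(p : (EuclideanSpace ℝ (Fin 3))) - q‖ ^ 2)⁻¹) ^ 7 + ((‖(p : (EuclideanSpace ℝ (Fin 3))) - q‖ ^ 2)⁻¹) ^ 4) • (v p - v q) + (2 * ⟪(p : (EuclideanSpace ℝ (Fin 3))) - q, v p - v q⟫ * (7 * ((‖(p : (EuclideanSpace ℝ (Fin 3))) - q‖ ^ 2)⁻¹) ^ 8 - 4 * ((‖(p : (EuclideanSpace ℝ (Fin 3))) - q‖ ^ 2)⁻¹) ^ 5)) • ((p : (EuclideanSpace ℝ (Fin 3))) - q)) else 0), v p⟫)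
    {h : (EuclideanSpace ℝ (Fin 3)) → (EuclideanSpace ℝ (Fin 3))} {B : ℝ} (hB : ∀ x, ‖h x‖ ≤ B) {η : (EuclideanSpace ℝ (Fin 3)) → ℝ} (hη : (Function.support η).Finite)
    (hηS : Function.support η ⊆ Sites₀ t A) :
    κ * nnForm t A (fun x => η x • h x) ≤
      (∑' p : Sites₀ t A, (η p) ^ 2 * ⟪∑' q : Sites₀ t A, (if (p : (EuclideanSpace ℝ (Fin 3))) ≠ q then ((-((‖(p : (EuclideanSpace ℝ (Fin 3))) - q‖ ^ 2)⁻¹) ^ 7 + ((‖(p : (EuclideanSpace ℝ (Fin 3))) - q‖ ^ 2)⁻¹) ^ 4) • (h p - h q) + (2 * ⟪(p : (EuclideanSpace ℝ (Fin 3))) - q, h p - h q⟫ * (7 * ((‖(p : (EuclideanSpace ℝ (Fin 3))) - q‖ ^ 2)⁻¹) ^ 8 - 4 * ((‖(p : (EuclideanSpace ℝ (Fin 3))) - q‖ ^ 2)⁻¹) ^ 5)) • ((p : (EuclideanSpace ℝ (Fin 3))) - q)) else 0), h p⟫) +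
      (1 / 2 : ℝ) * ∑' p : Sites₀ t A, ∑' q : Sites₀ t A, (if (p : (EuclideanSpace ℝ (Fin 3))) ≠ q then (η p - η q) ^ 2 * ⟪((-((‖(p : (EuclideanSpace ℝ (Fin 3))) - q‖ ^ 2)⁻¹) ^ 7 + ((‖(p : (EuclideanSpace ℝ (Fin 3))) - q‖ ^ 2)⁻¹) ^ 4) • (h p) + (2 * ⟪(p : (EuclideanSpace ℝ (Fin 3))) - q, h p⟫ * (7 * ((‖(p : (EuclideanSpace ℝ (Fin 3))) - q‖ ^ 2)⁻¹) ^ 8 - 4 * ((‖(p : (EuclideanSpace ℝ (Fin 3))) - q‖ ^ 2)⁻¹) ^ 5)) • ((p : (EuclideanSpace ℝ (Fin 3))) - q)), h q⟫ else 0) := by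
  have ha : (Function.support fun x : (EuclideanSpace ℝ (Fin 3)) => η x • h x).Finite :=
    hη.subset fun x hx => by
      simp only [Function.mem_support, ne_eq, smul_eq_zero, not_or] at hx ⊢
      exact hx.1
  have haS : (Function.support fun x : (EuclideanSpace ℝ (Fin 3)) => η x • h x) ⊆ Sites₀ t A := fun x hx => by
    apply hηS
    simp only [Function.mem_support, ne_eq, smul_eq_zero, not_or] at hx ⊢
    exact hx.1
  have h1 := hκ _ ha haS
  have h2 := caccioppoli_identity hA hI hB hη (a := fun x => η x • h x) (fun x => rfl)
  linarith [h1, h2]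

end

end Summit.AtomisticToContinuum.Crystallization.Theorems.ExcessDecayLiouville

end
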